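import Literature.AnabelianGeometry.SemiGraphs.OrbitGraphOrbits
import Literature.AnabelianGeometry.SemiGraphs.UniversalCoveringOver

/-!
# Transport of equivariant maps along branches for a split covering ([SemiAnbd] §3 pp. 37–38)

For coverings `S`, `T` of `𝒢` with `S` splitting `T` (`S.Splits T`: the stabiliser of any point of
`S` acts trivially on the corresponding fibre of `T` — the splitting condition of Def. 3.5 (ii)),
an `S`-orbit `V ⊆ S_v` and the set `M(V)` of `Π_v`-equivariant maps `V → T_v`: a branch
`b : e → v` and an `S`-orbit `E ⊆ S_e` gluing into `V` induce a BIJECTION `M(E) ≃ M(V)`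
(`orbitHomEquiv`): restriction along the gluing, and extension `g · glue(y) ↦ g · glue(m y)`, well
defined exactly because of the splitting.  This is the local step of the universal property of the
coverings `𝒢_{∞,S}` ("every tempered covering split by `𝒢_i` is dominated by `𝒢_{∞,i}`",
[SemiAnbd] p. 38, proof of Prop. 3.6).
-/

namespace Literature.AnabelianGeometry.SemiGraphs

namespace ProfiniteSemiGraph

open CategoryTheory

universe u

variable {𝒢 : ProfiniteSemiGraph.{u}} (S T : CovObj 𝒢)

/-- The inverse gluing on points of the vertex fibre, landing in the edge fibre over any edge equal
to `edgeOf b` (cast-free presentation). [cite: MochizukiSemiAnbd2006, Def 3.5(i) p.37] -/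
def CovObj.glueVInv (b : 𝒢.graph.Branch) (v : 𝒢.graph.Vertex) (h : 𝒢.graph.abuts b = some v) :
    (e : 𝒢.graph.Edge) → e = 𝒢.graph.edgeOf b → (S.SV v).obj.V → (S.SE e).obj.V
  | _, rfl, x => (S.glue b v h).inv.hom.hom x

/-- `glueV (glueVInv x) = x`. [cite: MochizukiSemiAnbd2006, Def 3.5(i) p.37] -/
theorem CovObj.glueV_glueVInv (b : 𝒢.graph.Branch) (v : 𝒢.graph.Vertex)
    (h : 𝒢.graph.abuts b = some v) (e : 𝒢.graph.Edge) (he : e = 𝒢.graph.edgeOf b)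
    (x : (S.SV v).obj.V) : S.glueV b v h ⟨e, S.glueVInv b v h e he x⟩ he = x := by
  subst he
  exact S.glue_hom_inv b v h x

/-- `glueVInv (glueV y) = y`. [cite: MochizukiSemiAnbd2006, Def 3.5(i) p.37] -/
theorem CovObj.glueVInv_glueV (b : 𝒢.graph.Branch) (v : 𝒢.graph.Vertex)
    (h : 𝒢.graph.abuts b = some v) (e : 𝒢.graph.Edge) (he : e = 𝒢.graph.edgeOf b)
    (y : (S.SE e).obj.V) : S.glueVInv b v h e he (S.glueV b v h ⟨e, y⟩ he) = y := by
  subst he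
  exact S.glue_inv_hom b v h y

/-- Equivariance of `glueV`: `glue (g · y) = b_*(g) · glue y`. [cite: MochizukiSemiAnbd2006, Def 3.5(i) p.37] -/
theorem CovObj.glueV_ρ (b : 𝒢.graph.Branch) (v : 𝒢.graph.Vertex)
    (h : 𝒢.graph.abuts b = some v) (e : 𝒢.graph.Edge) (he : e = 𝒢.graph.edgeOf b)
    (g : 𝒢.Ge e) (y : (S.SE e).obj.V) :
    S.glueV b v h ⟨e, (S.SE e).obj.ρ g y⟩ he =
      (S.SV v).obj.ρ (𝒢.brHom b v h (he ▸ g)) (S.glueV b v h ⟨e, y⟩ he) := by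
  subst he
  exact S.glue_ρ b v h g y

/-- Equivariance of `glueVInv`. [cite: MochizukiSemiAnbd2006, Def 3.5(i) p.37] -/
theorem CovObj.glueVInv_ρ (b : 𝒢.graph.Branch) (v : 𝒢.graph.Vertex)
    (h : 𝒢.graph.abuts b = some v) (e : 𝒢.graph.Edge) (he : e = 𝒢.graph.edgeOf b)
    (g : 𝒢.Ge e) (x : (S.SV v).obj.V) :
    S.glueVInv b v h e he ((S.SV v).obj.ρ (𝒢.brHom b v h (he ▸ g)) x) =
      (S.SE e).obj.ρ g (S.glueVInv b v h e he x) := by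
  have h1 := S.glueV_ρ b v h e he g (S.glueVInv b v h e he x)
  rw [S.glueV_glueVInv] at h1
  rw [← h1, S.glueVInv_glueV]

/-- The points of the vertex-orbit `V` of `S`. [cite: MochizukiSemiAnbd2006, Def 3.5(i) p.37] -/
abbrev CovObj.OVertex.Pts (V : S.OVertex) : Type u :=
  {x : (S.SV (CovObj.OVertex.base S V)).obj.V // Quot.mk S.VRel ⟨_, x⟩ = V}

/-- The points of the edge-orbit `E` of `S`. [cite: MochizukiSemiAnbd2006, Def 3.5(i) p.37] -/
abbrev CovObj.OEdge.Pts (E : S.OEdge) : Type u :=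
  {y : (S.SE (CovObj.OEdge.base S E)).obj.V // Quot.mk S.ERel ⟨_, y⟩ = E}

/-- The action of `Π_v` on the points of a vertex-orbit. [cite: MochizukiSemiAnbd2006, Def 3.5(i) p.37] -/
def CovObj.OVertex.act (V : S.OVertex) (g : 𝒢.Gv (CovObj.OVertex.base S V))
    (x : CovObj.OVertex.Pts S V) : CovObj.OVertex.Pts S V :=
  ⟨(S.SV _).obj.ρ g x.1, (Quot.sound (CovObj.VRel.mk (S := S) _ g x.1)).symm.trans x.2⟩

/-- The action of `Π_e` on the points of an edge-orbit. [cite: MochizukiSemiAnbd2006, Def 3.5(i) p.37] -/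
def CovObj.OEdge.act (E : S.OEdge) (g : 𝒢.Ge (CovObj.OEdge.base S E))
    (y : CovObj.OEdge.Pts S E) : CovObj.OEdge.Pts S E :=
  ⟨(S.SE _).obj.ρ g y.1, (Quot.sound (CovObj.ERel.mk (S := S) _ g y.1)).symm.trans y.2⟩

/-- `M(V)`: the `Π_v`-equivariant maps from the `S`-orbit `V` to the fibre `T_v`.
[cite: MochizukiSemiAnbd2006, Prop 3.6 p.38] -/
def CovObj.OrbitHomV (V : S.OVertex) : Type u :=
  { m : CovObj.OVertex.Pts S V → (T.SV (CovObj.OVertex.base S V)).obj.V //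
    ∀ (g : 𝒢.Gv _) (x : CovObj.OVertex.Pts S V),
      m (CovObj.OVertex.act S V g x) = (T.SV _).obj.ρ g (m x) }

/-- `M(E)`: the `Π_e`-equivariant maps from the `S`-orbit `E` to the fibre `T_e`.
[cite: MochizukiSemiAnbd2006, Prop 3.6 p.38] -/
def CovObj.OrbitHomE (E : S.OEdge) : Type u :=
  { m : CovObj.OEdge.Pts S E → (T.SE (CovObj.OEdge.base S E)).obj.V //
    ∀ (g : 𝒢.Ge _) (y : CovObj.OEdge.Pts S E),
      m (CovObj.OEdge.act S E g y) = (T.SE _).obj.ρ g (m y) }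

variable {S T}

section Branch

/-- The abutment vertex equation for a branch of `𝔾_S`. [cite: MochizukiSemiAnbd2006, Def 3.5(i) p.37] -/
theorem CovObj.abuts_of_orbitGraph_abuts (b : 𝒢.graph.Branch) (E : S.OEdge)
    (hE : CovObj.OEdge.base S E = 𝒢.graph.edgeOf b) (V : S.OVertex)
    (hv : S.orbitGraph.abuts ⟨(b, E), hE⟩ = some V) :
    𝒢.graph.abuts b = some (CovObj.OVertex.base S V) :=
  S.orbitGraphProj.abuts_branchMap ⟨(b, E), hE⟩ V hv

/-- The gluing sends the points of `E` into `V`. [cite: MochizukiSemiAnbd2006, Def 3.5(i) p.37] -/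
theorem CovObj.glueV_mem (b : 𝒢.graph.Branch) (E : S.OEdge)
    (hE : CovObj.OEdge.base S E = 𝒢.graph.edgeOf b) (V : S.OVertex)
    (hv : S.orbitGraph.abuts ⟨(b, E), hE⟩ = some V) (y : CovObj.OEdge.Pts S E) :
    Quot.mk S.VRel ⟨_, S.glueV b _ (CovObj.abuts_of_orbitGraph_abuts b E hE V hv) ⟨_, y.1⟩ hE⟩ = V := by
  obtain ⟨y, hy⟩ := y
  revert hE hv
  induction E using Quot.ind with
  | mk pr =>
  obtain ⟨e', y'⟩ := pr
  intro hE
  cases hE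
  intro hv
  change Quot.mk S.ERel ⟨_, y⟩ = Quot.mk S.ERel ⟨_, y'⟩ at hy
  exact (Option.some.inj ((S.orbitGraph_abuts_mk b _
    (CovObj.abuts_of_orbitGraph_abuts b _ rfl V hv) ⟨Quot.mk _ ⟨_, y'⟩, rfl⟩ y hy).symm.trans hv))

/-- The glued point of `E` in `V`. [cite: MochizukiSemiAnbd2006, Def 3.5(i) p.37] -/
def CovObj.gluePt (b : 𝒢.graph.Branch) (E : S.OEdge)
    (hE : CovObj.OEdge.base S E = 𝒢.graph.edgeOf b) (V : S.OVertex)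
    (hv : S.orbitGraph.abuts ⟨(b, E), hE⟩ = some V) (y : CovObj.OEdge.Pts S E) :
    CovObj.OVertex.Pts S V :=
  ⟨S.glueV b _ (CovObj.abuts_of_orbitGraph_abuts b E hE V hv) ⟨_, y.1⟩ hE,
    CovObj.glueV_mem b E hE V hv y⟩

/-- Every point of `V` is a translate of a glued point of `E`. [cite: MochizukiSemiAnbd2006, Def 3.5(i) p.37] -/
theorem CovObj.exists_eq_act_gluePt (b : 𝒢.graph.Branch) (E : S.OEdge)
    (hE : CovObj.OEdge.base S E = 𝒢.graph.edgeOf b) (V : S.OVertex)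
    (hv : S.orbitGraph.abuts ⟨(b, E), hE⟩ = some V) (x : CovObj.OVertex.Pts S V) :
    ∃ (y : CovObj.OEdge.Pts S E) (g : 𝒢.Gv _),
      x = CovObj.OVertex.act S V g (CovObj.gluePt b E hE V hv y) := by
  obtain ⟨y₀, hy₀⟩ := CovObj.OEdge.exists_rep S E
  have h1 := (CovObj.gluePt b E hE V hv ⟨y₀, hy₀⟩).2
  have h2 := x.2
  obtain ⟨g, hg⟩ := S.exists_ρ_of_mk_eq_mk (h1.trans h2.symm)
  exact ⟨⟨y₀, hy₀⟩, g, Subtype.ext hg.symm⟩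

end Branch

section Transport

variable (hsplit : S.Splits T) (b : 𝒢.graph.Branch) (E : S.OEdge)
  (hE : CovObj.OEdge.base S E = 𝒢.graph.edgeOf b) (V : S.OVertex)
  (hv : S.orbitGraph.abuts ⟨(b, E), hE⟩ = some V)

/-- Composition of the orbit action. [cite: MochizukiSemiAnbd2006, Def 3.5(i) p.37] -/
theorem CovObj.OVertex.act_mul (g g' : 𝒢.Gv (CovObj.OVertex.base S V)) (x : CovObj.OVertex.Pts S V) :
    CovObj.OVertex.act S V (g' * g) x = CovObj.OVertex.act S V g' (CovObj.OVertex.act S V g x) := by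
  apply Subtype.ext
  change (S.SV _).obj.ρ (g' * g) x.1 = (S.SV _).obj.ρ g' ((S.SV _).obj.ρ g x.1)
  rw [map_mul]
  rfl

/-- The gluing of points is equivariant along `b_*`. [cite: MochizukiSemiAnbd2006, Def 3.5(i) p.37] -/
theorem CovObj.gluePt_act (g : 𝒢.Ge (CovObj.OEdge.base S E)) (y : CovObj.OEdge.Pts S E) :
    CovObj.gluePt b E hE V hv (CovObj.OEdge.act S E g y) =
      CovObj.OVertex.act S V (𝒢.brHom b _ (CovObj.abuts_of_orbitGraph_abuts b E hE V hv) (hE ▸ g))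
        (CovObj.gluePt b E hE V hv y) :=
  Subtype.ext (S.glueV_ρ b _ (CovObj.abuts_of_orbitGraph_abuts b E hE V hv) _ hE g y.1)

/-- **Restriction** `M(V) → M(E)` along the gluing of the branch `b`.
[cite: MochizukiSemiAnbd2006, Prop 3.6 p.38] -/
def CovObj.orbitHomRes (m : CovObj.OrbitHomV S T V) : CovObj.OrbitHomE S T E :=
  ⟨fun y => T.glueVInv b _ (CovObj.abuts_of_orbitGraph_abuts b E hE V hv) _ hE
      (m.1 (CovObj.gluePt b E hE V hv y)),
    fun g y => by
      show T.glueVInv b _ _ _ hE (m.1 (CovObj.gluePt b E hE V hv (CovObj.OEdge.act S E g y))) =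
        (T.SE _).obj.ρ g (T.glueVInv b _ _ _ hE (m.1 (CovObj.gluePt b E hE V hv y)))
      rw [CovObj.gluePt_act, m.2, T.glueVInv_ρ]⟩

include hsplit in
/-- Well-definedness of the extension: the value `g · glue (m y)` only depends on the point
`x = g · glue y` of `V` (this is where the splitting `S.Splits T` is used).
[cite: MochizukiSemiAnbd2006, Prop 3.6 p.38] -/
theorem CovObj.ext_welldef (m : CovObj.OrbitHomE S T E) (y y₁ : CovObj.OEdge.Pts S E)
    (g g₁ : 𝒢.Gv (CovObj.OVertex.base S V))
    (h : CovObj.OVertex.act S V g (CovObj.gluePt b E hE V hv y) =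
      CovObj.OVertex.act S V g₁ (CovObj.gluePt b E hE V hv y₁)) :
    (T.SV _).obj.ρ g (T.glueV b _ (CovObj.abuts_of_orbitGraph_abuts b E hE V hv) ⟨_, m.1 y⟩ hE) =
      (T.SV _).obj.ρ g₁ (T.glueV b _ (CovObj.abuts_of_orbitGraph_abuts b E hE V hv) ⟨_, m.1 y₁⟩ hE) := by
  -- `y₁ = k · y`
  obtain ⟨k, hk⟩ := S.exists_ρE_of_mk_eq_mk (y.2.trans y₁.2.symm)
  have hy₁ : y₁ = CovObj.OEdge.act S E k y := Subtype.ext hk.symm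
  subst hy₁
  rw [CovObj.gluePt_act, ← CovObj.OVertex.act_mul] at h
  -- the element `g⁻¹ * (g₁ * b k)` stabilises `glue y`, hence acts trivially on `T_v`
  set k' := 𝒢.brHom b _ (CovObj.abuts_of_orbitGraph_abuts b E hE V hv) (hE ▸ k) with hk'
  have hval : (S.SV _).obj.ρ g (CovObj.gluePt b E hE V hv y).1 =
      (S.SV _).obj.ρ (g₁ * k') (CovObj.gluePt b E hE V hv y).1 := congrArg Subtype.val h
  have hstab : (S.SV _).obj.ρ (g⁻¹ * (g₁ * k')) (CovObj.gluePt b E hE V hv y).1 =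
      (CovObj.gluePt b E hE V hv y).1 := by
    rw [map_mul]
    change (S.SV _).obj.ρ g⁻¹ ((S.SV _).obj.ρ (g₁ * k') (CovObj.gluePt b E hE V hv y).1) = _
    rw [← hval]
    exact Action.ρ_inv_self_apply g _
  have htriv := hsplit.1 _ _ _ hstab
  -- evaluate at `z := glue (m y)`
  have hm : m.1 (CovObj.OEdge.act S E k y) = (T.SE _).obj.ρ k (m.1 y) := m.2 k y
  rw [hm, T.glueV_ρ b _ _ _ hE k (m.1 y)]
  set z := T.glueV b _ (CovObj.abuts_of_orbitGraph_abuts b E hE V hv) ⟨_, m.1 y⟩ hE with hz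
  change (T.SV _).obj.ρ g z = (T.SV _).obj.ρ g₁ ((T.SV _).obj.ρ k' z)
  have h1 := htriv z
  have e1 : (T.SV (CovObj.OVertex.base S V)).obj.ρ g z =
      (T.SV _).obj.ρ (g * (g⁻¹ * (g₁ * k'))) z := by
    rw [map_mul]
    exact (congrArg (fun s => (T.SV (CovObj.OVertex.base S V)).obj.ρ g s) h1).symm
  rw [e1, mul_inv_cancel_left, map_mul]
  rfl

/-- **Extension** `M(E) → M(V)`: `g · glue(y) ↦ g · glue(m y)` (well defined by `ext_welldef`).
[cite: MochizukiSemiAnbd2006, Prop 3.6 p.38] -/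
noncomputable def CovObj.orbitHomExt (m : CovObj.OrbitHomE S T E) : CovObj.OrbitHomV S T V :=
  ⟨fun x => (T.SV _).obj.ρ (CovObj.exists_eq_act_gluePt b E hE V hv x).choose_spec.choose
      (T.glueV b _ (CovObj.abuts_of_orbitGraph_abuts b E hE V hv)
        ⟨_, m.1 (CovObj.exists_eq_act_gluePt b E hE V hv x).choose⟩ hE),
    fun g' x => by
      have hx := (CovObj.exists_eq_act_gluePt b E hE V hv x).choose_spec.choose_spec
      have hx' := (CovObj.exists_eq_act_gluePt b E hE V hv (CovObj.OVertex.act S V g' x)).choose_spec.choose_spec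
      -- both `(y', g'')` for `g' · x` and `(y, g' * g)` represent `g' · x`
      have key := CovObj.ext_welldef hsplit b E hE V hv m
        (CovObj.exists_eq_act_gluePt b E hE V hv (CovObj.OVertex.act S V g' x)).choose
        (CovObj.exists_eq_act_gluePt b E hE V hv x).choose
        (CovObj.exists_eq_act_gluePt b E hE V hv (CovObj.OVertex.act S V g' x)).choose_spec.choose
        (g' * (CovObj.exists_eq_act_gluePt b E hE V hv x).choose_spec.choose)
        (by rw [← hx', CovObj.OVertex.act_mul, ← hx])
      beta_reduce
      rw [key, map_mul]
      rfl⟩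

include hsplit in
/-- The value of the extension on `g · glue(y)`. [cite: MochizukiSemiAnbd2006, Prop 3.6 p.38] -/
theorem CovObj.orbitHomExt_apply (m : CovObj.OrbitHomE S T E) (y : CovObj.OEdge.Pts S E)
    (g : 𝒢.Gv (CovObj.OVertex.base S V)) :
    (CovObj.orbitHomExt hsplit b E hE V hv m).1 (CovObj.OVertex.act S V g (CovObj.gluePt b E hE V hv y)) =
      (T.SV _).obj.ρ g (T.glueV b _ (CovObj.abuts_of_orbitGraph_abuts b E hE V hv) ⟨_, m.1 y⟩ hE) := by
  have hx := (CovObj.exists_eq_act_gluePt b E hE V hv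
    (CovObj.OVertex.act S V g (CovObj.gluePt b E hE V hv y))).choose_spec.choose_spec
  exact CovObj.ext_welldef hsplit b E hE V hv m _ _ _ _ hx.symm

/-- The trivial translate: `act 1 x = x`. [cite: MochizukiSemiAnbd2006, Def 3.5(i) p.37] -/
theorem CovObj.OVertex.act_one (x : CovObj.OVertex.Pts S V) : CovObj.OVertex.act S V 1 x = x := by
  apply Subtype.ext
  change (S.SV _).obj.ρ 1 x.1 = x.1
  rw [map_one]
  rfl

include hsplit in
/-- **The transport bijection `M(E) ≃ M(V)` along the branch `b`** (extension and restriction are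
mutually inverse). [cite: MochizukiSemiAnbd2006, Prop 3.6 p.38] -/
noncomputable def CovObj.orbitHomEquiv : CovObj.OrbitHomE S T E ≃ CovObj.OrbitHomV S T V where
  toFun := CovObj.orbitHomExt hsplit b E hE V hv
  invFun := CovObj.orbitHomRes b E hE V hv
  left_inv m := by
    apply Subtype.ext
    funext y
    change T.glueVInv b _ _ _ hE ((CovObj.orbitHomExt hsplit b E hE V hv m).1 (CovObj.gluePt b E hE V hv y)) = m.1 y
    have h1 := CovObj.orbitHomExt_apply hsplit b E hE V hv m y 1
    rw [CovObj.OVertex.act_one, map_one] at h1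
    rw [h1]
    exact T.glueVInv_glueV b _ _ _ hE (m.1 y)
  right_inv m' := by
    apply Subtype.ext
    funext x
    obtain ⟨y, g, hx⟩ := CovObj.exists_eq_act_gluePt b E hE V hv x
    rw [hx, CovObj.orbitHomExt_apply hsplit b E hE V hv]
    change (T.SV _).obj.ρ g (T.glueV b _ _ ⟨_, T.glueVInv b _ _ _ hE (m'.1 _)⟩ hE) = _
    rw [T.glueV_glueVInv, ← m'.2]

end Transport

end ProfiniteSemiGraph

end Literature.AnabelianGeometry.SemiGraphs
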